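import Literature.AlgebraicGeometry.Frobenioids.SupportsRealAction
import Literature.AlgebraicGeometry.Frobenioids.ElementaryFrobeniusFunctor
import HarnessLib

/-!
# Frobenioids I, Def. 2.4 (iii), `Λ = ℝ`: "multiplication by `d ∈ ℝ_{>0}`" on a monoid `Φ` on `D`
# supported by `ℝ`, and the subfunctor `d · Φ ⊆ Φ`

Mochizuki, *The geometry of Frobenioids I*, Kyushu J. Math. **62** (2008), §2, Definition 2.4 (iii) p. 48:
"Let `Λ` be a monoid type that supports `Φ` [cf. Definition 1.1, (ii)]; `d ∈ Λ_{>0}`.  Then we shall write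
`d · Φ(−) ⊆ Φ(−)` for the subfunctor of `Φ` determined by the assignment … `A ↦ d · Φ(A)`"
[cite: MochizukiFrdI2008, Def. 2.4(iii) p.48].

`ElementaryFrobeniusFunctor.lean` (seat abc-iut-L1-t2) types Def. 2.4 (iii) over a GENERAL endomorphism
`δ : Φ → Φ` ("for `Λ = ℚ, ℝ` the endomorphism 'multiplication by `d ∈ Λ_{>0}`' is supplied as a general
`δ`").  For `Λ = ℝ` THE endomorphism is now available (`SupportsRealAction.lean`): the powers
`a ↦ a^d` of the `Φ(A)` (each supported by `ℝ`) are natural in `A` because EVERY homomorphism between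
monoids supported by `ℝ` commutes with them (`Supports.map_realPow`).  This file packages them as the
natural endomorphism `realPowEnd Φ hS d : Φ ⟶ Φ` and names `d · Φ := imageMonoid (realPowEnd Φ hS d)`.
Seat abc-iut-L1-d2 (cell abc-iut), row «FrdI:Def2.4(ii)-ℝ-action + I3-MERGE» (L1-lead R45 (4)).
-/

noncomputable section

namespace Literature.AlgebraicGeometry.Frobenioids

open CategoryTheory Opposite

universe w v u

variable {D : Type u} [Category.{v} D] (Φ : Dᵒᵖ ⥤ CommMonCat.{w})
  (hS : ∀ X : Dᵒᵖ, Supports (Φ.obj X) .R)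

/-- **"Multiplication by `d ∈ ℝ_{>0}`" on a monoid `Φ` on `D` supported by `ℝ`** (Def. 2.4 (iii), `Λ = ℝ`):
the natural endomorphism `Φ → Φ` with components the powers `a ↦ a^d` (`Supports.realPow`); naturality is
`Supports.map_realPow`.  (Defined for all `d ∈ ℝ_{≥0}`; `d = 0` gives the trivial endomorphism.)
[cite: MochizukiFrdI2008, Def. 2.4(iii) p.48] -/
def realPowEnd (d : NNReal) : Φ ⟶ Φ where
  app X := CommMonCat.ofHom ((hS X).realPow d)
  naturality X Y f := by
    apply CommMonCat.hom_ext
    apply MonoidHom.ext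
    intro a
    change (hS Y).realPow d ((Φ.map f).hom a) = (Φ.map f).hom ((hS X).realPow d a)
    exact ((hS X).map_realPow (hS Y) (Φ.map f).hom d a).symm

/-- Components of `realPowEnd`. [cite: MochizukiFrdI2008, Def. 2.4(iii) p.48] -/
@[simp] theorem realPowEnd_app_hom (d : NNReal) (X : Dᵒᵖ) :
    ((realPowEnd Φ hS d).app X).hom = (hS X).realPow d := rfl

/-- `realPowEnd 1 = id`. [cite: MochizukiFrdI2008, Def. 2.4(iii) p.48] -/
theorem realPowEnd_one : realPowEnd Φ hS 1 = 𝟙 Φ := by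
  ext X a
  exact (hS X).realPow_one a

/-- `realPowEnd (d d') = realPowEnd d' ≫ realPowEnd d` ("multiplication by `d d'`").
[cite: MochizukiFrdI2008, Def. 2.4(iii) p.48] -/
theorem realPowEnd_mul (d d' : NNReal) : realPowEnd Φ hS (d * d') = realPowEnd Φ hS d' ≫ realPowEnd Φ hS d := by
  ext X a
  exact (hS X).realPow_mul d d' a

/-- For `d ∈ ℕ_{≥1}` the endomorphism is the `d`-th power map, i.e. t2's `powEnd` for `Λ = ℤ` agrees with
the `ℝ`-action on naturals. [cite: MochizukiFrdI2008, Def. 2.4(iii) p.48] -/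
theorem realPowEnd_natCast_app (n : ℕ) (X : Dᵒᵖ) (a : Φ.obj X) :
    ((realPowEnd Φ hS (n : NNReal)).app X).hom a = a ^ n :=
  (hS X).realPow_natCast n a

/-- Bridge to `Λ = ℤ`: for `d ∈ ℕ_{≥1}` the `ℝ`-action endomorphism IS t2's `powEnd Φ d` (the `d`-th power
maps). [cite: MochizukiFrdI2008, Def. 2.4(iii) p.48] -/
theorem realPowEnd_pnat (d : ℕ+) : realPowEnd Φ hS ((d : ℕ) : NNReal) = powEnd Φ d := by
  ext X a
  exact (hS X).realPow_natCast d a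

/-- **`d · Φ ⊆ Φ` for `Λ = ℝ`** (Def. 2.4 (iii)): the image subfunctor of "multiplication by `d`", as a
monoid on `D` (t2's `imageMonoid` at THE endomorphism). [cite: MochizukiFrdI2008, Def. 2.4(iii) p.48] -/
abbrev realMulImage (d : NNReal) : Dᵒᵖ ⥤ CommMonCat.{w} := imageMonoid (realPowEnd Φ hS d)

/-- For `d ≠ 0`, "multiplication by `d`" is bijective on each `Φ(A)`, so `d · Φ(A) = Φ(A)`: the inclusion
`d · Φ → Φ` is an isomorphism objectwise. [cite: MochizukiFrdI2008, Def. 2.4(iii) p.48] -/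
theorem realMulImage_eq_top {d : NNReal} (hd : d ≠ 0) (X : Dᵒᵖ) :
    imageSubmonoid (realPowEnd Φ hS d) X = ⊤ := by
  rw [eq_top_iff]
  intro a _
  obtain ⟨b, hb⟩ := (hS X).realPow_surjective hd a
  exact ⟨b, hb⟩

end Literature.AlgebraicGeometry.Frobenioids
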